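import Summits.HodgeConjecture.CorCM.Model.KunnethTopClass
import Summits.HodgeConjecture.CorCM.RationalExteriorSpan
import Literature.AlgebraicGeometry.HodgeTheory.HodgeRiemannDegreeOne
import Literature.AlgebraicTopology.CharacteristicClasses.ProjectiveSpaceLerayHirsch
import HarnessLib

/-!
# COR-CM model layer (row M22 `Fact_algDuality`, input R2 on the model's carriers), part 1:
# the binomial theorem for cup powers and the top power of a box sum `fst^* x + snd^* y`

Cell `pub-hodgecm2` (COR-CM), seat b15 (role of the unseated slot b26: the polarization datum consumed by
kernel K-a of row M22).  K-a (model-1, `M22-ALGDUALITY-PLAN.md` §3) needs, on the corner PRODUCT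
`P = A₀ × A₁ × A₂ × A₃`, a rational class `θ ∈ H²(P(ℂ); ℚ)` which is algebraic and whose top cup power
`θ^{dim P}` is non-zero.  The per-factor classes come from the Rosati-compatible polarizations of the factors;
this file supplies the PRODUCT STEP, pure algebraic topology of `X(ℂ) × Y(ℂ)`:

* `cupPow_add_eq_sum_choose` — the binomial theorem `(a + b)^k = Σ_i C(k,i) aⁱ ∪ b^{k-i}` for degree-two
  classes of ANY space (degree-two classes commute with everything by graded commutativity, Hatcher Thm. 3.11);
* `cupPow_boxSum_eq` — for smooth projective `X`, `Y` of dimensions `m`, `n` and `x ∈ H²(X; ℚ)`,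
  `y ∈ H²(Y; ℚ)`: `(fst^* x + snd^* y)^{m+n} = C(m+n, m) • fst^* x^m ∪ snd^* y^n` (all other binomial terms
  vanish above the top degree of a factor, Hatcher Thm. 3.26 (c));
* `cupPow_boxSum_ne_zero` — hence `x^m ≠ 0`, `y^n ≠ 0 ⇒ (fst^* x + snd^* y)^{m+n} ≠ 0` (the Künneth top-class
  lemma `cup_pull_fst_pull_snd_top_ne_zero` of `KunnethTopClass`, model-1);
* `boxSum_mem_ratAlgebraicClasses` — `fst^* x + snd^* y` is rational-algebraic when `x`, `y` are.

Cup powers are the tree's `CharacteristicClasses.cupPow ℚ x j ∈ H^{2j}` (`x⁰ = 1`, `x^{j+1} = xʲ ∪ x`).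
-/

noncomputable section

open CategoryTheory MonoidalCategory CartesianMonoidalCategory
open Literature.AlgebraicTopology.SingularHomology
open Literature.AlgebraicTopology.CharacteristicClasses (cupPow cupPow_zero cupPow_succ map_cupPow)
open Literature.AlgebraicGeometry.Motives (SchemeOver ComplexPoints IsSmoothProjective bettiCohomology)
open Literature.AlgebraicGeometry.HodgeTheory
open Literature.NumberTheory.Automorphic.PicardCM

namespace Summit.HodgeConjecture.CorCM.Model

/-! ### Degree-two classes commute with everything; the binomial theorem for cup powers -/

section Binomial

variable {R : Type} [CommRing R] {T : Type} [TopologicalSpace T]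

/-- **A degree-two class commutes with every class**: `x ∪ y = y ∪ x` for `x ∈ Hᵖ`, `y ∈ H²` (graded
commutativity with the sign `(-1)^{2p} = 1`). [cite: HatcherAT2002, §3.2 Thm. 3.11] -/
theorem cupProduct_comm_deg_two {p n : ℕ} (h : p + 2 = n) (h' : 2 + p = n)
    (x : singularCohomology R R T p) (y : singularCohomology R R T 2) :
    cupProduct h x y = cupProduct h' y x := by
  rw [cupProduct_gradedComm_holds R T h h' x y, (show Even (p * 2) from ⟨p, by ring⟩).neg_one_pow, one_smul]

/-- The degree equation of the binomial term `aⁱ ∪ b^{k-i} ∈ H^{2k}`, `i ≤ k`. [folklore] -/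
theorem two_mul_val_add_two_mul_sub {k : ℕ} (i : Fin (k + 1)) : 2 * (i : ℕ) + 2 * (k - i) = 2 * k := by
  have := i.2; omega

/-- Re-indexing of binomial terms along equal exponents (the degrees are propositionally, not
definitionally, equal). [folklore] -/
theorem cupProduct_cupPow_congr (a b : singularCohomology R R T 2) {i i' j j' n : ℕ} (hi : i = i')
    (hj : j = j') (h : 2 * i + 2 * j = n) (h' : 2 * i' + 2 * j' = n) :
    cupProduct h (cupPow R a i) (cupPow R b j) = cupProduct h' (cupPow R a i') (cupPow R b j') := by
  subst hi; subst hj; rfl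

/-- `(aⁱ ∪ bʲ) ∪ b = aⁱ ∪ b^{j+1}` (associativity). [cite: HatcherAT2002, §3.2] -/
theorem cupProduct_cupPow_cupPow_right (a b : singularCohomology R R T 2) {i j n N : ℕ}
    (h : 2 * i + 2 * j = n) (h' : n + 2 = N) (h'' : 2 * i + 2 * (j + 1) = N) :
    cupProduct h' (cupProduct h (cupPow R a i) (cupPow R b j)) b =
      cupProduct h'' (cupPow R a i) (cupPow R b (j + 1)) := by
  rw [cupPow_succ R b j]
  exact cupProduct_assoc h (show 2 * j + 2 = 2 * (j + 1) by omega) h' h'' _ _ _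

/-- `(aⁱ ∪ bʲ) ∪ a = a^{i+1} ∪ bʲ` (associativity and the commutation `bʲ ∪ a = a ∪ bʲ`).
[cite: HatcherAT2002, §3.2] -/
theorem cupProduct_cupPow_cupPow_left (a b : singularCohomology R R T 2) {i j n N : ℕ}
    (h : 2 * i + 2 * j = n) (h' : n + 2 = N) (h'' : 2 * (i + 1) + 2 * j = N) :
    cupProduct h' (cupProduct h (cupPow R a i) (cupPow R b j)) a =
      cupProduct h'' (cupPow R a (i + 1)) (cupPow R b j) := by
  rw [cupProduct_assoc h (show 2 * j + 2 = 2 * j + 2 from rfl) h' (show 2 * i + (2 * j + 2) = N by omega),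
    cupProduct_comm_deg_two (show 2 * j + 2 = 2 * j + 2 from rfl) (show 2 + 2 * j = 2 * j + 2 by omega)
      (cupPow R b j) a, cupPow_succ R a i]
  exact (cupProduct_assoc (show 2 * i + 2 = 2 * (i + 1) by omega) (show 2 + 2 * j = 2 * j + 2 by omega) h''
    (show 2 * i + (2 * j + 2) = N by omega) _ _ _).symm

/-- **The binomial theorem for cup powers of degree-two classes**:
`(a + b)^k = Σ_{i ≤ k} C(k, i) • aⁱ ∪ b^{k-i}` in `H^{2k}(T; R)`, for any space `T` and commutative ring `R`
(degree-two classes commute with everything). [cite: HatcherAT2002, §3.2 Thm. 3.11 and Example 3.12] -/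
theorem cupPow_add_eq_sum_choose (a b : singularCohomology R R T 2) (k : ℕ) :
    cupPow R (a + b) k = ∑ i : Fin (k + 1), ((k.choose i : ℕ) : R) •
      cupProduct (two_mul_val_add_two_mul_sub i) (cupPow R a i) (cupPow R b (k - i)) := by
  induction k with
  | zero =>
    rw [Fin.sum_univ_one]
    show singularCohomology.one R T = ((Nat.choose 0 0 : ℕ) : R) •
      cupProduct _ (singularCohomology.one R T) (singularCohomology.one R T)
    rw [Nat.choose_self, Nat.cast_one, one_smul]
    exact (one_cupProduct (singularCohomology.one R T)).symm
  | succ k ih =>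
    -- expand `(a+b)^{k+1} = (a+b)^k ∪ (a+b)` and distribute
    rw [cupPow_succ, ih, map_sum, LinearMap.sum_apply]
    simp only [map_smul, LinearMap.smul_apply, map_add, Finset.sum_add_distrib]
    -- the binomial terms of degree `2(k+1)`
    set F : Fin (k + 2) → singularCohomology R R T (2 * (k + 1)) := fun j =>
      cupProduct (two_mul_val_add_two_mul_sub j) (cupPow R a j) (cupPow R b (k + 1 - j)) with hF
    -- the two families of terms, re-indexed
    have hA : ∀ i : Fin (k + 1),
        cupProduct (show 2 * k + 2 = 2 * (k + 1) by omega)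
            (cupProduct (two_mul_val_add_two_mul_sub i) (cupPow R a i) (cupPow R b (k - i))) a = F i.succ := by
      intro i
      have hi := i.2
      rw [hF, cupProduct_cupPow_cupPow_left a b _ _ (show 2 * (i + 1) + 2 * (k - i) = 2 * (k + 1) by omega)]
      exact cupProduct_cupPow_congr a b (by simp [Fin.val_succ]) (by simp [Fin.val_succ]) _ _
    have hB : ∀ i : Fin (k + 1),
        cupProduct (show 2 * k + 2 = 2 * (k + 1) by omega)
            (cupProduct (two_mul_val_add_two_mul_sub i) (cupPow R a i) (cupPow R b (k - i))) b = F i.castSucc := by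
      intro i
      have hi := i.2
      rw [hF, cupProduct_cupPow_cupPow_right a b _ _ (show 2 * i + 2 * (k - i + 1) = 2 * (k + 1) by omega)]
      exact cupProduct_cupPow_congr a b (by simp) (by simp only [Fin.val_castSucc]; omega) _ _
    have eA : ∑ i : Fin (k + 1), ((k.choose i : ℕ) : R) • cupProduct (show 2 * k + 2 = 2 * (k + 1) by omega)
          (cupProduct (two_mul_val_add_two_mul_sub i) (cupPow R a i) (cupPow R b (k - i))) a =
        ∑ i : Fin (k + 1), ((k.choose i : ℕ) : R) • F i.succ :=
      Finset.sum_congr rfl fun i _ => by rw [hA i]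
    have eB : ∑ i : Fin (k + 1), ((k.choose i : ℕ) : R) • cupProduct (show 2 * k + 2 = 2 * (k + 1) by omega)
          (cupProduct (two_mul_val_add_two_mul_sub i) (cupPow R a i) (cupPow R b (k - i))) b =
        ∑ i : Fin (k + 1), ((k.choose i : ℕ) : R) • F i.castSucc :=
      Finset.sum_congr rfl fun i _ => by rw [hB i]
    rw [eA, eB]
    change ∑ i : Fin (k + 1), ((k.choose i : ℕ) : R) • F i.succ +
        ∑ i : Fin (k + 1), ((k.choose i : ℕ) : R) • F i.castSucc =
      ∑ j : Fin (k + 2), (((k + 1).choose j : ℕ) : R) • F j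
    -- binomial re-indexing: Pascal's rule
    rw [Fin.sum_univ_succ (fun j : Fin (k + 2) => (((k + 1).choose j : ℕ) : R) • F j),
      Fin.sum_univ_succ (fun i : Fin (k + 1) => ((k.choose i : ℕ) : R) • F i.castSucc)]
    have hP : ∀ i : Fin (k + 1), (((k + 1).choose (i.succ : ℕ) : ℕ) : R) =
        ((k.choose i : ℕ) : R) + ((k.choose (i + 1) : ℕ) : R) := by
      intro i
      rw [Fin.val_succ, Nat.choose_succ_succ', Nat.cast_add]
    simp only [hP, add_smul, Finset.sum_add_distrib]
    rw [Fin.sum_univ_castSucc (fun i : Fin (k + 1) => ((k.choose i : ℕ) : R) • F i.succ),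
      Fin.sum_univ_castSucc (fun i : Fin (k + 1) => ((k.choose (i + 1) : ℕ) : R) • F i.succ)]
    simp only [Fin.val_zero, Nat.choose_zero_right, Fin.castSucc_zero, Fin.val_last, Nat.choose_succ_self,
      Nat.cast_zero, zero_smul, add_zero, Fin.val_succ, Fin.val_castSucc, Fin.succ_castSucc, Nat.cast_one,
      one_smul, Nat.choose_self]
    abel

end Binomial

/-! ### The top power of a box sum on a product of smooth projective varieties -/

section BoxSum

variable {m n : ℕ} {X Y : SchemeOver ℂ}

/-- **Cup powers above the dimension vanish**: `xⁱ = 0` in `H^{2i}(X(ℂ); ℚ)` for `i > dim X`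
(`Hᵏ(X(ℂ); ℚ) = 0` for `k > 2 dim X`). [cite: HatcherAT2002, §3.3 Thm. 3.26] -/
theorem cupPow_eq_zero_of_dim_lt (hX : IsSmoothProjective m X) (x : bettiCohomology X 2) {i : ℕ}
    (hi : m < i) : cupPow ℚ x i = 0 := by
  haveI := Literature.AlgebraicGeometry.Motives.ComplexPoints.subsingleton_singularCohomology_of_lt hX ℚ
    (k := 2 * i) (by omega)
  exact Subsingleton.elim _ _

/-- Pull-back commutes with cup powers (`f^*(yⁱ) = (f^* y)ⁱ`, model spelling `BettiUniverse.pull`).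
[cite: HatcherAT2002, §3.2 Prop. 3.10] -/
theorem pull_cupPow (f : X ⟶ Y) (y : bettiCohomology Y 2) (i : ℕ) :
    BettiUniverse.pull f (2 * i) (cupPow ℚ y i) = cupPow ℚ (BettiUniverse.pull f 2 y) i :=
  map_cupPow ℚ _ y i

/-- **The top power of a box sum**: for smooth projective `X`, `Y` of dimensions `m`, `n` and degree-two
classes `x`, `y`, `(fst^* x + snd^* y)^{m+n} = C(m+n, m) • fst^*(x^m) ∪ snd^*(y^n)` — in the binomial expansion
every other term contains a power `xⁱ`, `i > m`, or `yʲ`, `j > n`, which vanishes above the top degree of the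
factor. [cite: HatcherAT2002, §3.2 Thm. 3.11 and §3.3 Thm. 3.26] -/
theorem cupPow_boxSum_eq (hX : IsSmoothProjective m X) (hY : IsSmoothProjective n Y)
    (x : bettiCohomology X 2) (y : bettiCohomology Y 2) :
    cupPow ℚ (BettiUniverse.pull (fst X Y) 2 x + BettiUniverse.pull (snd X Y) 2 y) (m + n) =
      ((m + n).choose m : ℚ) • cupProduct (two_mul_add_two_mul m n)
        (BettiUniverse.pull (fst X Y) (2 * m) (cupPow ℚ x m))
        (BettiUniverse.pull (snd X Y) (2 * n) (cupPow ℚ y n)) := by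
  rw [cupPow_add_eq_sum_choose, Finset.sum_eq_single (⟨m, by omega⟩ : Fin (m + n + 1))]
  · -- the surviving term `i = m`
    rw [pull_cupPow, pull_cupPow]
    exact congrArg _ (cupProduct_cupPow_congr _ _ rfl (Nat.add_sub_cancel_left m n) _ _)
  · -- the other terms vanish
    intro i _ hi
    have him : (i : ℕ) ≠ m := fun h ↦ hi (Fin.ext h)
    have hik := i.2
    rcases Nat.lt_or_gt_of_ne him with h | h
    · rw [← pull_cupPow (snd X Y) y, cupPow_eq_zero_of_dim_lt hY y (show n < m + n - i by omega), map_zero,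
        map_zero, smul_zero]
    · rw [← pull_cupPow (fst X Y) x, cupPow_eq_zero_of_dim_lt hX x h, map_zero, map_zero,
        LinearMap.zero_apply, smul_zero]
  · exact fun h ↦ absurd (Finset.mem_univ _) h

/-- **Non-vanishing of the top power of a box sum**: if `x^m ≠ 0` on `X` and `y^n ≠ 0` on `Y` then
`(fst^* x + snd^* y)^{m+n} ≠ 0` on `X ⊗ Y` (the Künneth top-class lemma `cup_pull_fst_pull_snd_top_ne_zero`:
`fst^* x^m ∪ snd^* y^n ≠ 0`). [cite: HatcherAT2002, §3.2 Thm. 3.15] -/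
theorem cupPow_boxSum_ne_zero (hX : IsSmoothProjective m X) (hY : IsSmoothProjective n Y)
    {x : bettiCohomology X 2} (hx : cupPow ℚ x m ≠ 0) {y : bettiCohomology Y 2} (hy : cupPow ℚ y n ≠ 0) :
    cupPow ℚ (BettiUniverse.pull (fst X Y) 2 x + BettiUniverse.pull (snd X Y) 2 y) (m + n) ≠ 0 := by
  rw [cupPow_boxSum_eq hX hY]
  refine smul_ne_zero ?_ fun h0 ↦ ?_
  · exact_mod_cast (Nat.choose_pos (Nat.le_add_right m n)).ne'
  · exact cup_pull_fst_pull_snd_top_ne_zero hX hY hx hy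
      ((cupProduct_eq_zero_iff_of_eq (two_mul_add_two_mul m n) rfl _ _).1 h0)

/-- **A box sum of rational algebraic divisor classes is rational algebraic.** [cite: Fulton1998, Cor. 19.2 (b)] -/
theorem boxSum_mem_ratAlgebraicClasses (hX : IsSmoothProjective m X) (hY : IsSmoothProjective n Y)
    {x : bettiCohomology X 2} (hx : x ∈ ratAlgebraicClasses X 1) {y : bettiCohomology Y 2}
    (hy : y ∈ ratAlgebraicClasses Y 1) :
    BettiUniverse.pull (fst X Y) 2 x + BettiUniverse.pull (snd X Y) 2 y ∈ ratAlgebraicClasses (X ⊗ Y) 1 :=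
  add_mem
    (ratAlgebraicClasses_map_pull_le hX
      (Literature.AlgebraicGeometry.Motives.IsSmoothProjective.tensor_holds hX hY) (fst X Y) 1 ⟨x, hx, rfl⟩)
    (ratAlgebraicClasses_map_pull_le hY
      (Literature.AlgebraicGeometry.Motives.IsSmoothProjective.tensor_holds hX hY) (snd X Y) 1 ⟨y, hy, rfl⟩)

end BoxSum

/-! ### The four-fold corner product `P = ((A₀ ⊗ A₁) ⊗ A₂) ⊗ A₃` -/

section Prod4

variable {g₀ g₁ g₂ g₃ : ℕ} {A₀ A₁ A₂ A₃ : SchemeOver ℂ}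

/-- The sum `Σᵢ prᵢ^* θᵢ` on the left-nested product `((A₀ ⊗ A₁) ⊗ A₂) ⊗ A₃`, with the projections spelled as
in the package's `Universe.pr4` (`pr₀ = fst ≫ fst ≫ fst`, `pr₁ = fst ≫ fst ≫ snd`, `pr₂ = fst ≫ snd`, `pr₃ = snd`),
is the iterated box sum `fst^*(fst^*(fst^* θ₀ + snd^* θ₁) + snd^* θ₂) + snd^* θ₃`. [folklore] -/
theorem prod4Sum_eq_boxSum (θ₀ : bettiCohomology A₀ 2) (θ₁ : bettiCohomology A₁ 2)
    (θ₂ : bettiCohomology A₂ 2) (θ₃ : bettiCohomology A₃ 2) :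
    BettiUniverse.pull (fst ((A₀ ⊗ A₁) ⊗ A₂) A₃ ≫ fst (A₀ ⊗ A₁) A₂ ≫ fst A₀ A₁) 2 θ₀ +
        BettiUniverse.pull (fst ((A₀ ⊗ A₁) ⊗ A₂) A₃ ≫ fst (A₀ ⊗ A₁) A₂ ≫ snd A₀ A₁) 2 θ₁ +
        BettiUniverse.pull (fst ((A₀ ⊗ A₁) ⊗ A₂) A₃ ≫ snd (A₀ ⊗ A₁) A₂) 2 θ₂ +
        BettiUniverse.pull (snd ((A₀ ⊗ A₁) ⊗ A₂) A₃) 2 θ₃ =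
      BettiUniverse.pull (fst ((A₀ ⊗ A₁) ⊗ A₂) A₃) 2
          (BettiUniverse.pull (fst (A₀ ⊗ A₁) A₂) 2
              (BettiUniverse.pull (fst A₀ A₁) 2 θ₀ + BettiUniverse.pull (snd A₀ A₁) 2 θ₁) +
            BettiUniverse.pull (snd (A₀ ⊗ A₁) A₂) 2 θ₂) +
        BettiUniverse.pull (snd ((A₀ ⊗ A₁) ⊗ A₂) A₃) 2 θ₃ := by
  simp only [BettiUniverse.pull_comp, LinearMap.comp_apply, map_add]

/-- **Non-vanishing of the top power of `Σᵢ prᵢ^* θᵢ` on the corner product**: if `θᵢ^{gᵢ} ≠ 0` on the smooth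
projective `Aᵢ` of dimension `gᵢ` (`i < 4`), then `(Σᵢ prᵢ^* θᵢ)^{g₀+g₁+g₂+g₃} ≠ 0` on `((A₀ ⊗ A₁) ⊗ A₂) ⊗ A₃`.
[cite: HatcherAT2002, §3.2 Thm. 3.15] -/
theorem cupPow_prod4Sum_ne_zero (h₀ : IsSmoothProjective g₀ A₀) (h₁ : IsSmoothProjective g₁ A₁)
    (h₂ : IsSmoothProjective g₂ A₂) (h₃ : IsSmoothProjective g₃ A₃)
    {θ₀ : bettiCohomology A₀ 2} {θ₁ : bettiCohomology A₁ 2} {θ₂ : bettiCohomology A₂ 2}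
    {θ₃ : bettiCohomology A₃ 2} (hθ₀ : cupPow ℚ θ₀ g₀ ≠ 0) (hθ₁ : cupPow ℚ θ₁ g₁ ≠ 0)
    (hθ₂ : cupPow ℚ θ₂ g₂ ≠ 0) (hθ₃ : cupPow ℚ θ₃ g₃ ≠ 0) :
    cupPow ℚ (BettiUniverse.pull (fst ((A₀ ⊗ A₁) ⊗ A₂) A₃ ≫ fst (A₀ ⊗ A₁) A₂ ≫ fst A₀ A₁) 2 θ₀ +
        BettiUniverse.pull (fst ((A₀ ⊗ A₁) ⊗ A₂) A₃ ≫ fst (A₀ ⊗ A₁) A₂ ≫ snd A₀ A₁) 2 θ₁ +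
        BettiUniverse.pull (fst ((A₀ ⊗ A₁) ⊗ A₂) A₃ ≫ snd (A₀ ⊗ A₁) A₂) 2 θ₂ +
        BettiUniverse.pull (snd ((A₀ ⊗ A₁) ⊗ A₂) A₃) 2 θ₃) (g₀ + g₁ + g₂ + g₃) ≠ 0 := by
  rw [prod4Sum_eq_boxSum]
  have h01 := Literature.AlgebraicGeometry.Motives.IsSmoothProjective.tensor_holds h₀ h₁
  have h012 := Literature.AlgebraicGeometry.Motives.IsSmoothProjective.tensor_holds h01 h₂
  exact cupPow_boxSum_ne_zero h012 h₃
    (cupPow_boxSum_ne_zero h01 h₂ (cupPow_boxSum_ne_zero h₀ h₁ hθ₀ hθ₁) hθ₂) hθ₃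

/-- **`Σᵢ prᵢ^* θᵢ` is rational algebraic on the corner product** when every `θᵢ` is a rational algebraic
divisor class. [cite: Fulton1998, Cor. 19.2 (b)] -/
theorem prod4Sum_mem_ratAlgebraicClasses (h₀ : IsSmoothProjective g₀ A₀) (h₁ : IsSmoothProjective g₁ A₁)
    (h₂ : IsSmoothProjective g₂ A₂) (h₃ : IsSmoothProjective g₃ A₃)
    {θ₀ : bettiCohomology A₀ 2} {θ₁ : bettiCohomology A₁ 2} {θ₂ : bettiCohomology A₂ 2}
    {θ₃ : bettiCohomology A₃ 2} (hθ₀ : θ₀ ∈ ratAlgebraicClasses A₀ 1) (hθ₁ : θ₁ ∈ ratAlgebraicClasses A₁ 1)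
    (hθ₂ : θ₂ ∈ ratAlgebraicClasses A₂ 1) (hθ₃ : θ₃ ∈ ratAlgebraicClasses A₃ 1) :
    BettiUniverse.pull (fst ((A₀ ⊗ A₁) ⊗ A₂) A₃ ≫ fst (A₀ ⊗ A₁) A₂ ≫ fst A₀ A₁) 2 θ₀ +
        BettiUniverse.pull (fst ((A₀ ⊗ A₁) ⊗ A₂) A₃ ≫ fst (A₀ ⊗ A₁) A₂ ≫ snd A₀ A₁) 2 θ₁ +
        BettiUniverse.pull (fst ((A₀ ⊗ A₁) ⊗ A₂) A₃ ≫ snd (A₀ ⊗ A₁) A₂) 2 θ₂ +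
        BettiUniverse.pull (snd ((A₀ ⊗ A₁) ⊗ A₂) A₃) 2 θ₃ ∈
      ratAlgebraicClasses (((A₀ ⊗ A₁) ⊗ A₂) ⊗ A₃) 1 := by
  rw [prod4Sum_eq_boxSum]
  have h01 := Literature.AlgebraicGeometry.Motives.IsSmoothProjective.tensor_holds h₀ h₁
  have h012 := Literature.AlgebraicGeometry.Motives.IsSmoothProjective.tensor_holds h01 h₂
  exact boxSum_mem_ratAlgebraicClasses h012 h₃
    (boxSum_mem_ratAlgebraicClasses h01 h₂ (boxSum_mem_ratAlgebraicClasses h₀ h₁ hθ₀ hθ₁) hθ₂) hθ₃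

end Prod4

/-! ### Descent of a complex polarization class to the rational Betti carriers -/

section Descent

variable {g : ℕ} {A : SchemeOver ℂ}

/-- The tree's two cup-power recursions agree on complex classes: `CharacteristicClasses.cupPow ℂ x i`
(any coefficient ring) `= ChernCharacterBetti.cupPowTwo x i` (complex coefficients). [cite: HatcherAT2002, §3.2] -/
theorem cupPow_complex_eq_cupPowTwo {Y : Type} [TopologicalSpace Y] (x : singularCohomology ℂ ℂ Y 2) :
    ∀ i : ℕ, cupPow ℂ x i = cupPowTwo x i
  | 0 => rfl
  | i + 1 => by rw [cupPow_succ, cupPowTwo_succ, cupPow_complex_eq_cupPowTwo x i]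

/-- The rational lattice commutes with cup powers: `(θⁱ) ⊗ 1 = (θ ⊗ 1)ⁱ`. [cite: HatcherAT2002, §3.2 p. 215] -/
theorem ofRatClass_cupPow {Y : Type} [TopologicalSpace Y] (θ : singularCohomology ℚ ℚ Y 2) :
    ∀ i : ℕ, ofRatClass Y (2 * i) (cupPow ℚ θ i) = cupPowTwo (ofRatClass Y 2 θ) i
  | 0 => by rw [cupPow_zero, cupPowTwo_zero]; exact ofRatClass_one
  | i + 1 => by
    rw [cupPow_succ, cupPowTwo_succ, ofRatClass_eq_ringChange, singularCohomology.ringChange_cupProduct,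
      ← ofRatClass_eq_ringChange, ← ofRatClass_eq_ringChange, ofRatClass_cupPow θ i]

/-- **Descent of a polarization class.**  A rational, algebraic class `h ∈ H²(A(ℂ); ℂ)` some multiple `s • h`
of which is a Kähler class (as supplied by the Rosati-compatible polarizations of CM abelian varieties,
Deligne 1982 §4–5 / Shimura 1998 §6.2 Thm. 4) descends to a class `θ ∈ H²(A(ℂ); ℚ)` on the model's rational
carriers which is rational-algebraic (`ratAlgebraicClasses A 1`) and has non-zero top cup power `θ^g ≠ 0`
(`g = dim A ≥ 1`; powers of a Kähler class do not vanish, Voisin I Cor. 3.9).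
[cite: VoisinHodgeI2002, §3.1.3 Cor. 3.9] -/
theorem exists_rat_of_polarizationClass (hA : IsSmoothProjective g A) (hg : 1 ≤ g) {h : complexBetti A 2}
    (hrat : IsRationalClass h) (halg : h ∈ algebraicClasses A 1) {s : ℂ} (hK : IsKaehlerClass g A (s • h)) :
    ∃ θ : bettiCohomology A 2, ofRatClass (ComplexPoints A) 2 θ = h ∧ θ ∈ ratAlgebraicClasses A 1 ∧
      cupPow ℚ θ g ≠ 0 := by
  obtain ⟨θ, rfl⟩ := (isRationalClass_iff_mem_range_ofRatClass h).1 hrat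
  refine ⟨θ, rfl, (mem_ratAlgebraicClasses_iff A 1 θ).2 halg, fun h0 ↦ ?_⟩
  have hne : cupPowTwo (s • ofRatClass (ComplexPoints A) 2 θ) g ≠ 0 := hK.cupPowTwo_ne_zero hA hg le_rfl
  rw [cupPowTwo_smul, ← ofRatClass_cupPow, h0, map_zero, smul_zero] at hne
  exact hne rfl

end Descent

end Summit.HodgeConjecture.CorCM.Model

end
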